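import Summits.KontsevichZagierPeriods.Zeta5Search.LaiSweepShard

/-!
# `κ₃` sweep certificate — shard file 044 of 127 (shards 308–314 of 889)

HONEST FRAMING. Systematic search; no irrationality claim unless certified. This file only checks,
by `decide +kernel`, shards 308–314 of the order-cell sweep of the `κ₃` point `(74, 2180, 444; δ74)`
(engine `LaiSweepEngine`, soundness `LaiSweepJump/Free/Eval/Shard/Kappa3`; a shard is `⟨regime, n,
p, q, p', q', Lo, Up⟩`: `n` cells from `p/q` to `p'/q'` with integer rate sums in `[Lo, Up]`, `K =
128`, `D = 2^40`). It draws NO conclusion: only the capstone `LaiKappa3SweepCert`, which needs all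
127 shard files, does. Kernel cost of this file ≈ 560 cells × 0.3 s.
-/

namespace Summit.KontsevichZagierPeriods.Zeta5Search.Sweep

set_option maxHeartbeats 100000000 in
/-- Shard 308: 80 cells of regime B from `111/412` to `36/133`.
[cite: Lai2024BallRivoal, §4 Lemma 4.3] -/
theorem shard308 :
    Shard.check 128 (2^40)
      ⟨true, 80, 111, 412, 36, 133, 24874473249837, 26275250130610⟩ = true := by
  decide +kernel

set_option maxHeartbeats 100000000 in
/-- Shard 309: 80 cells of regime B from `36/133` to `90/331`.
[cite: Lai2024BallRivoal, §4 Lemma 4.3] -/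
theorem shard309 :
    Shard.check 128 (2^40)
      ⟨true, 80, 36, 133, 90, 331, 24140160571900, 25513681837875⟩ = true := by
  decide +kernel

set_option maxHeartbeats 100000000 in
/-- Shard 310: 80 cells of regime B from `90/331` to `103/377`.
[cite: Lai2024BallRivoal, §4 Lemma 4.3] -/
theorem shard310 :
    Shard.check 128 (2^40)
      ⟨true, 80, 90, 331, 103, 377, 25584196100135, 27058347209522⟩ = true := by
  decide +kernel

set_option maxHeartbeats 100000000 in
/-- Shard 311: 80 cells of regime B from `103/377` to `73/266`.
[cite: Lai2024BallRivoal, §4 Lemma 4.3] -/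
theorem shard311 :
    Shard.check 128 (2^40)
      ⟨true, 80, 103, 377, 73, 266, 23938017805831, 25328985073388⟩ = true := by
  decide +kernel

set_option maxHeartbeats 100000000 in
/-- Shard 312: 80 cells of regime B from `73/266` to `94/341`.
[cite: Lai2024BallRivoal, §4 Lemma 4.3] -/
theorem shard312 :
    Shard.check 128 (2^40)
      ⟨true, 80, 73, 266, 94, 341, 23777910948434, 25173877264551⟩ = true := by
  decide +kernel

set_option maxHeartbeats 100000000 in
/-- Shard 313: 80 cells of regime B from `94/341` to `18/65`.
[cite: Lai2024BallRivoal, §4 Lemma 4.3] -/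
theorem shard313 :
    Shard.check 128 (2^40)
      ⟨true, 80, 94, 341, 18, 65, 24465197504332, 25916552437643⟩ = true := by
  decide +kernel

set_option maxHeartbeats 100000000 in
/-- Shard 314: 80 cells of regime B from `18/65` to `37/133`.
[cite: Lai2024BallRivoal, §4 Lemma 4.3] -/
theorem shard314 :
    Shard.check 128 (2^40)
      ⟨true, 80, 18, 65, 37, 133, 24532737058456, 26003794395634⟩ = true := by
  decide +kernel

/-- The checked shards of this file, in order. [folklore] -/
def shards044 : List (CheckedShard 128 (2^40)) :=
  [⟨_, shard308⟩, ⟨_, shard309⟩, ⟨_, shard310⟩, ⟨_, shard311⟩, ⟨_, shard312⟩,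
    ⟨_, shard313⟩, ⟨_, shard314⟩]

end Summit.KontsevichZagierPeriods.Zeta5Search.Sweep
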